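import Summits.BirchSwinnertonDyer.Rank1Residual.Additive.RamifiedSevenGenusFactorisationShape
import Literature.NumberTheory.ComplexMultiplication.EllipticUnits.SemilocalUnitTowerDataGalois
import Literature.NumberTheory.EllipticCurves.IwasawaCyclotomicProofs
import HarnessLib

/-!
# `𝒞₇` genus road, row (GENUS-PORT-A2) block (U1a), part 1: the `Υ`-ACTION of F4's pinned datum `𝓤` is a
# representation factoring through a FINITE quotient `Q` of order prime to `p` — normal layers, Galois
# translates, `actHom`, `towerHom`, `#Q ∈ ℤ_pˣ` (construction from the pins; no named fact)

Cell bsd-cm, seat bsd-cm-k-ty1 g24; SUMMON `wake/SUMMON-bsd-cm-k-ty1-20260830T1331Z.md` (b9377bcdb48ad2d0) block (U1)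
«the projector `e_{η₁} = 12⁻¹ Σ η₁(g)⁻¹ g` … (the finite `Υ`-action: CHECK (proj))»; check (proj) answered on HOME STATUS
2026-08-30T13:46Z: NO frame-side gap.  ADDITIVE file: the shapes file `RamifiedSevenGenusFactorisationShape.lean` (B1a;
names frozen) is imported and untouched.  Part 2 (`RamifiedSevenGenusProjector.lean`) builds `e_χ` on this.  HONEST
LABEL: infrastructure; K1ᵘ is NOT proved; no item closes; no stub is registered; stmt-BirchSwinnertonDyer-19945 is OPEN;
`X12.CMRamifiedSeven` is NOT proved; BSD is claimed for no curve.

## What is proved, and from what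

F4 (`Literature/NumberTheory/IwasawaTheory/CyclotomicColemanMap.lean` §4) pins `𝓤 = lim← 𝓤_{K_n}` as a datum
`D : CyclotomicSemilocalUnitData p v (cyclotomicLayer F₀ p) … (torsionCyclotomicSubgroup p) γ₀` whose `Υ`-action
`D.act : Υ → 𝓤 →ₗ[Λ] 𝓤` (`Υ = Gal(ℚ̄/B_∞)`, an infinite group) is tied to Galois only by pin (A) `rep_act` (its level-`n`
projection is any `υ`-translate of the projection) and (I) joint injectivity.  From these pins and NOTHING else:

* §1 the layers `K_n = F₀ ⊔ ℚ(μ_{p^{n+1}})` are NORMAL over `ℚ` when `F₀` is (splitting field of `X^{p^{n+1}} − 1`;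
  Mathlib `IntermediateField.normal_sup`).
* §2 hence (cf2 cell's `galTranslate`, `EllipticUnits/SemilocalUnitTowerDataGalois.lean` §1, stated for any base number
  field) translates exist on every layer (`layerTranslate`), `rep n (act υ m)` IS the translate, `D.act` is a
  representation `CyclotomicAction.actHom : Υ →* End_Λ(𝓤)` (`act (υυ') = act υ ∘ act υ'`, `act 1 = id` inside `actHom`), and
  `act υ = id` whenever `υ` fixes the tower pointwise.
* §3 the finite quotient: for `F₀ = ℚ({x | x^k = a})` (the genus frame: `k = 2`, `a = D`) the hom
  `towerHom : Υ →* μ_t(ℤ_p) × Sym{x | x^k = a}`, `υ ↦ (χ_cyc υ, υ|_{roots})` (`(ℤ_pˣ)_tors ≤ μ_t`, `t = φ(p)` for odd `p`,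
  tree `PadicInt.torsion_units_le_rootsOfUnity`; the roots form a `Γ_ℚ`-stable finite set `rootSubMulAction`); its KERNEL
  fixes every `p`-power root of unity (`GaloisRep.cyclotomicCharacter_spec`) and the roots, hence every `K_n` pointwise
  (the fixed field of `υ` is an intermediate field containing `F₀` and `μ_{p^{n+1}}`); `Q := Υ ⧸ ker(towerHom)` is FINITE
  with `#Q ∣ #μ_t(ℤ_p)·(#{x | x^k = a})!`, so `p ∤ #Q` for odd `p` and `k < p`: `#Q ∈ ℤ_pˣ` (`isUnit_card_towerQuot`) — the
  print's `|G| = 12`, `12⁻¹ ∈ ℤ₇`, up to passing to the IMAGE of `Υ` (surjectivity onto `Gal(K_0/ℚ)` is neither needed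
  nor claimed).

TECHNICAL NOTE (the `ℚ`-algebra diamond on `↥L`, `L ≤ ℚ̄`): `Normal ℚ ↥L` synthesised here and the instance expected by
lemmas generic in the base field differ by `DivisionRing.toRatAlgebra` vs `IntermediateField.algebra'` (definitionally,
not instance-reducibly, equal); normality is therefore passed EXPLICITLY (`normal_cyclotomicLayer F₀ p hF₀ n` into
`@galTranslate`), never by instance search; no `instance` is declared, no notation.

## References
T. Tsuji, J. Number Theory 78 (1999) §2 (pp. 3–4), §3 (pp. 5–6: `𝓤`, `G = Gal(K/ℚ)`, «Gal(K_n/ℚ) ≅ G × Gal(K_n/K)»,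
«modules over ℤ_p[G]⟦Γ⟧»), Remark 3 (p. 9) [Tsuji1999]; J.-P. Serre, *A Course in Arithmetic*, Ch. II §3.1 Prop. 7
[Serre1973]; K. Rubin, Invent. Math. 103 (1991) §4 p. 36 [Rubin1991]; frozen memo `MEMO-bsd-cm-genus` v1
(a38f3eedd2c92d58) §1 (N4); scope F8 (16530c741a99cc96).
-/

noncomputable section

open scoped NumberField
open PowerSeries IsDedekindDomain Field
open Literature.NumberTheory.EllipticCurves
open Literature.NumberTheory.IwasawaTheory
open Literature.NumberTheory.ComplexMultiplication.EllipticUnits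
open Literature.NumberTheory.NumberFields

namespace Summit.BirchSwinnertonDyer.Rank1Residual.Additive.GenusSeven

/-! ## §1 The layers `K_n = F₀(μ_{p^{n+1}})` are normal over `ℚ`; Galois translates exist on them -/

section Layers

variable (F₀ : IntermediateField ℚ (AlgebraicClosure ℚ)) (p : ℕ)

/-- `{x | x^N = 1}` is the root set of `X^N − 1` in `ℚ̄` (`N ≥ 1`). [cite: Tsuji1999, §3 (p. 5, K_n = F(μ_{p^{n+1}}))] -/
theorem setOf_pow_eq_one_eq_rootSet {N : ℕ} (hN : 0 < N) :
    {x : AlgebraicClosure ℚ | x ^ N = 1} =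
      ((Polynomial.X ^ N - 1 : Polynomial ℚ).rootSet (AlgebraicClosure ℚ)) := by
  ext x
  have hne : (Polynomial.X ^ N - 1 : Polynomial ℚ) ≠ 0 :=
    Polynomial.X_pow_sub_C_ne_zero hN 1
  rw [Set.mem_setOf_eq, Polynomial.mem_rootSet_of_ne hne, map_sub, map_pow, Polynomial.aeval_X,
    map_one, sub_eq_zero]

/-- `ℚ(μ_{p^{n+1}}) ⊆ ℚ̄` is normal over `ℚ` (a splitting field of `X^{p^{n+1}} − 1`).
[cite: Tsuji1999, §3 (p. 5)] -/
theorem normal_adjoin_rootsOfUnity [Fact p.Prime] (n : ℕ) :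
    Normal ℚ (IntermediateField.adjoin ℚ {x : AlgebraicClosure ℚ | x ^ p ^ (n + 1) = 1}) := by
  rw [setOf_pow_eq_one_eq_rootSet (pow_pos (Fact.out : p.Prime).pos _)]
  set P : Polynomial ℚ := Polynomial.X ^ p ^ (n + 1) - 1
  haveI hP := IntermediateField.adjoin_rootSet_isSplittingField
    (IsAlgClosed.splits (P.map (algebraMap ℚ (AlgebraicClosure ℚ))))
  exact Normal.of_isSplittingField (hFEp := hP)

/-- **The layer `K_n = F₀ ⊔ ℚ(μ_{p^{n+1}})` is normal over `ℚ`** when `F₀` is. [cite: Tsuji1999, §3 (p. 6, L1–5: «Gal(K_n/ℚ) ≅ G × Gal(K_n/K)»)] -/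
theorem normal_cyclotomicLayer [Fact p.Prime] (hF₀ : Normal ℚ F₀) (n : ℕ) : Normal ℚ (cyclotomicLayer F₀ p n) := by
  rw [cyclotomicLayer_def]
  exact @IntermediateField.normal_sup ℚ (AlgebraicClosure ℚ) _ _ _ F₀ _ hF₀ (normal_adjoin_rootsOfUnity p n)

end Layers

/-! ## §2 The `Υ`-action of F4's pinned datum is a representation factoring through a finite quotient -/

namespace CyclotomicAction

variable {p : ℕ} [Fact p.Prime] {v : HeightOneSpectrum (𝓞 ℚ)} {F₀ : IntermediateField ℚ (AlgebraicClosure ℚ)}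
  {γ₀ : absoluteGaloisGroup ℚ}
  (D : CyclotomicSemilocalUnitData p v (cyclotomicLayer F₀ p) (cyclotomicLayer_monotone F₀ p)
    (torsionCyclotomicSubgroup p) γ₀)

/-- (A) for a `υ` fixing the level `K_n` pointwise: `act υ m` and `m` have the same projection there.
[cite: Tsuji1999, §3 (pp. 5–6)] -/
theorem rep_act_of_forall_fixed (υ : torsionCyclotomicSubgroup p) (n : ℕ)
    (hυ : ∀ x : cyclotomicLayer F₀ p n, (υ : absoluteGaloisGroup ℚ) • (x : AlgebraicClosure ℚ) = x)
    (m : D.M) : D.rep n (D.act υ m) = D.rep n m :=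
  D.rep_act υ n m (D.rep n m) (IsGaloisTranslate.self_of_forall_fixed v (cyclotomicLayer F₀ p n) υ hυ _)

/-- **`act υ = id` whenever `υ` fixes every layer** — the action factors through the image of `Υ` in
`Gal(K_∞/ℚ)`. [cite: Tsuji1999, §3 (p. 6, «𝓤 and 𝒞 are modules over ℤ_p[G]⟦Γ⟧»)] -/
theorem act_apply_eq_self_of_forall_fixed (υ : torsionCyclotomicSubgroup p)
    (hυ : ∀ (n : ℕ) (x : cyclotomicLayer F₀ p n), (υ : absoluteGaloisGroup ℚ) • (x : AlgebraicClosure ℚ) = x)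
    (m : D.M) : D.act υ m = m :=
  D.eq_of_rep_eq _ _ fun n => rep_act_of_forall_fixed D υ n (hυ n) m

variable (hF₀ : Normal ℚ F₀)
include hF₀

/-- The Galois translate `(1 ⊗ σ|_{K_n})` on the local units of the (normal) layer `K_n` — the cf2 cell's
`galTranslate` with the normality of `K_n` supplied (the `ℚ`-algebra instance on `↥K_n` is passed explicitly).
[cite: Tsuji1999, §3 (pp. 5–6)] -/
def layerTranslate (n : ℕ) (σ : absoluteGaloisGroup ℚ) :
    (Semilocal.order ℚ v (cyclotomicLayer F₀ p n))ˣ →* (Semilocal.order ℚ v (cyclotomicLayer F₀ p n))ˣ :=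
  @galTranslate ℚ _ _ v (cyclotomicLayer F₀ p n) (normal_cyclotomicLayer F₀ p hF₀ n) σ

omit [Fact p.Prime] in
/-- `layerTranslate n σ x` is a `σ`-translate of `x`. [cite: Tsuji1999, §3 (pp. 5–6)] -/
theorem isGaloisTranslate_layerTranslate [Fact p.Prime] (n : ℕ) (σ : absoluteGaloisGroup ℚ)
    (x : (Semilocal.order ℚ v (cyclotomicLayer F₀ p n))ˣ) :
    IsGaloisTranslate v (cyclotomicLayer F₀ p n) σ x (layerTranslate (v := v) hF₀ n σ x) :=
  @isGaloisTranslate_galTranslate ℚ _ _ v (cyclotomicLayer F₀ p n) (normal_cyclotomicLayer F₀ p hF₀ n) σ x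

/-- (A) on the normal layer `K_n`: `rep n (act υ m)` IS the Galois translate `(1 ⊗ υ|_{K_n})(rep n m)`.
[cite: Tsuji1999, §3 (pp. 5–6)] -/
theorem rep_act_eq_layerTranslate (υ : torsionCyclotomicSubgroup p) (n : ℕ) (m : D.M) :
    D.rep n (D.act υ m) = layerTranslate (v := v) hF₀ n (υ : absoluteGaloisGroup ℚ) (D.rep n m) :=
  D.rep_act υ n m _ (isGaloisTranslate_layerTranslate hF₀ n _ _)

/-- **`act (υυ') = act υ ∘ act υ'`** (translate twice; joint injectivity (I)). [cite: Tsuji1999, §3 (p. 6)] -/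
theorem act_mul (υ υ' : torsionCyclotomicSubgroup p) : D.act (υ * υ') = D.act υ ∘ₗ D.act υ' := by
  refine LinearMap.ext fun m => D.eq_of_rep_eq _ _ fun n => ?_
  rw [LinearMap.comp_apply, rep_act_eq_layerTranslate D hF₀, rep_act_eq_layerTranslate D hF₀,
    rep_act_eq_layerTranslate D hF₀]
  refine IsGaloisTranslate.unique (isGaloisTranslate_layerTranslate hF₀ n _ (D.rep n m)) ?_
  rw [Subgroup.coe_mul]
  exact (isGaloisTranslate_layerTranslate hF₀ n _ _).trans (isGaloisTranslate_layerTranslate hF₀ n _ _)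

/-- **The `Υ`-action as a representation `Υ →* End_Λ(𝓤)`.** [cite: Tsuji1999, §3 (p. 6, «modules over the completed group ring ℤ_p[G]⟦Γ⟧»)] -/
def actHom : torsionCyclotomicSubgroup p →* Module.End (IwasawaAlgebra p) D.M where
  toFun := D.act
  map_one' := by
    rw [Module.End.one_eq_id]
    exact LinearMap.ext fun m => act_apply_eq_self_of_forall_fixed D 1 (fun _ _ => rfl) m
  map_mul' υ υ' := by rw [Module.End.mul_eq_comp]; exact act_mul D hF₀ υ υ'

/-- `actHom` is `act`. [cite: Tsuji1999, §3 (p. 6)] -/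
@[simp] theorem actHom_apply (υ : torsionCyclotomicSubgroup p) : actHom D hF₀ υ = D.act υ := rfl

end CyclotomicAction

/-! ## §3 The finite quotient `Q = Υ ⧸ N` through which `Υ` acts (`N` = automorphisms fixing `μ_{p^∞}` and the roots generating `F₀`) -/

section RootAction

variable (k : ℕ) (a : ℤ)

/-- The roots `{x ∈ ℚ̄ | x^k = a}` as a `Γ_ℚ`-stable subset of `ℚ̄` (a `SubMulAction`): `(σx)^k = σ(x^k) = σ(a) = a`.
[cite: Tsuji1999, §3 (p. 5, «F a finite abelian extension of ℚ»)] -/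
def rootSubMulAction : SubMulAction (absoluteGaloisGroup ℚ) (AlgebraicClosure ℚ) where
  carrier := {x : AlgebraicClosure ℚ | x ^ k = (a : AlgebraicClosure ℚ)}
  smul_mem' σ x hx := by
    simp only [Set.mem_setOf_eq] at hx ⊢
    rw [← smul_pow', hx, absoluteGaloisGroup.smul_def, map_intCast]

/-- Membership in `rootSubMulAction`. [cite: Tsuji1999, §3 (p. 5)] -/
theorem mem_rootSubMulAction_iff (x : AlgebraicClosure ℚ) :
    x ∈ rootSubMulAction k a ↔ x ^ k = (a : AlgebraicClosure ℚ) := Iff.rfl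

/-- For `k ≥ 1` there are at most `k` such roots; in particular finitely many. [cite: Tsuji1999, §3 (p. 5)] -/
theorem finite_rootSubMulAction (hk : 0 < k) : (rootSubMulAction k a : Set (AlgebraicClosure ℚ)).Finite := by
  classical
  refine Set.Finite.subset (Polynomial.nthRoots k (a : AlgebraicClosure ℚ)).toFinset.finite_toSet fun x hx => ?_
  rw [Finset.mem_coe, Multiset.mem_toFinset, Polynomial.mem_nthRoots hk]
  exact hx

/-- `#{x | x^k = a} ≤ k` (`k ≥ 1`). [cite: Tsuji1999, §3 (p. 5)] -/
theorem card_rootSubMulAction_le (hk : 0 < k) : Nat.card (rootSubMulAction k a) ≤ k := by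
  classical
  have hsub : (rootSubMulAction k a : Set (AlgebraicClosure ℚ)) ⊆
      ((Polynomial.nthRoots k (a : AlgebraicClosure ℚ)).toFinset : Set (AlgebraicClosure ℚ)) := fun x hx => by
    rw [Finset.mem_coe, Multiset.mem_toFinset, Polynomial.mem_nthRoots hk]
    exact hx
  calc Nat.card (rootSubMulAction k a)
      = Nat.card ((rootSubMulAction k a : Set (AlgebraicClosure ℚ)) : Type) := rfl
    _ ≤ Nat.card (((Polynomial.nthRoots k (a : AlgebraicClosure ℚ)).toFinset : Set (AlgebraicClosure ℚ)) : Type) :=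
        Nat.card_mono (Finset.finite_toSet _) hsub
    _ = (Polynomial.nthRoots k (a : AlgebraicClosure ℚ)).toFinset.card := by
        rw [Nat.card_eq_card_finite_toFinset (Finset.finite_toSet _), Finset.finite_toSet_toFinset]
    _ ≤ Multiset.card (Polynomial.nthRoots k (a : AlgebraicClosure ℚ)) := Multiset.toFinset_card_le _
    _ ≤ k := Polynomial.card_nthRoots k _

end RootAction

section TowerQuotient

variable (p : ℕ) [Fact p.Prime] (F₀ : IntermediateField ℚ (AlgebraicClosure ℚ)) (k : ℕ) (a : ℤ)

/-- `torsionOrder p ≠ 0`. [cite: Serre1973, Ch. II §3.1 Prop. 7] -/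
theorem torsionOrder_ne_zero : torsionOrder p ≠ 0 :=
  (Nat.totient_pos.2 (pow_pos (Fact.out : p.Prime).pos _)).ne'

/-- **The hom `Υ → μ_t(ℤ_p) × Sym{x | x^k = a}`, `υ ↦ (χ_cyc(υ), υ|_{roots})`** (`t = #(ℤ_pˣ)_tors`): when
`F₀ = ℚ({x | x^k = a})`, its kernel fixes all `p`-power roots of unity and `F₀`, hence every layer `K_n`.
[cite: Tsuji1999, §3 (p. 6, L1–5: «Gal(K_n/ℚ) ≅ G × Gal(K_n/K)»)] -/
def towerHom : torsionCyclotomicSubgroup p →*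
    (rootsOfUnity (torsionOrder p) ℤ_[p]) × Equiv.Perm (rootSubMulAction k a) :=
  MonoidHom.prod
    (((Literature.NumberTheory.GaloisRepresentations.GaloisRep.cyclotomicCharacter ℚ p).toMonoidHom.comp
        (torsionCyclotomicSubgroup p).subtype).codRestrict _ fun υ =>
      PadicInt.torsion_units_le_rootsOfUnity ((mem_torsionCyclotomicSubgroup_iff p _).mp υ.2))
    ((MulAction.toPermHom (absoluteGaloisGroup ℚ) (rootSubMulAction k a)).comp (torsionCyclotomicSubgroup p).subtype)

/-- First component of `towerHom`: the cyclotomic character. [cite: Tsuji1999, §3 (p. 6)] -/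
theorem coe_towerHom_fst (υ : torsionCyclotomicSubgroup p) :
    ((towerHom p k a υ).1 : ℤ_[p]ˣ) =
      Literature.NumberTheory.GaloisRepresentations.GaloisRep.cyclotomicCharacter ℚ p υ := rfl

/-- Second component of `towerHom`: the permutation of the roots. [cite: Tsuji1999, §3 (p. 6)] -/
theorem towerHom_snd_apply (υ : torsionCyclotomicSubgroup p) (x : rootSubMulAction k a) :
    (((towerHom p k a υ).2 x : rootSubMulAction k a) : AlgebraicClosure ℚ) =
      (υ : absoluteGaloisGroup ℚ) • (x : AlgebraicClosure ℚ) := rfl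

/-- An automorphism with trivial cyclotomic character fixes every `p`-power root of unity.
[cite: Tsuji1999, §3 (p. 5, B_∞)] -/
theorem smul_eq_self_of_cyclotomicCharacter_eq_one (σ : absoluteGaloisGroup ℚ)
    (hσ : Literature.NumberTheory.GaloisRepresentations.GaloisRep.cyclotomicCharacter ℚ p σ = 1)
    {j : ℕ} {t : AlgebraicClosure ℚ} (ht : t ^ p ^ j = 1) : σ • t = t := by
  have h := Literature.NumberTheory.GaloisRepresentations.GaloisRep.cyclotomicCharacter_spec ℚ p
    (k := j) σ t ht
  rw [hσ, Units.val_one, map_one] at h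
  rcases Nat.lt_or_ge 1 (p ^ j) with hj | hj
  · haveI : Fact (1 < p ^ j) := ⟨hj⟩
    rwa [ZMod.val_one, pow_one] at h
  · have hpj : p ^ j = 1 :=
      le_antisymm hj (Nat.one_le_iff_ne_zero.mpr (pow_ne_zero _ (Fact.out : p.Prime).ne_zero))
    rw [hpj, pow_one] at ht
    rw [ht, smul_one]

/-- **The kernel of `towerHom` fixes every layer `K_n` pointwise** (when `F₀ = ℚ({x | x^k = a})`).
[cite: Tsuji1999, §3 (p. 6, L1–5)] -/
theorem smul_eq_self_of_towerHom_eq_one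
    (hF₀ : F₀ = IntermediateField.adjoin ℚ {x : AlgebraicClosure ℚ | x ^ k = (a : AlgebraicClosure ℚ)})
    (υ : torsionCyclotomicSubgroup p) (hυ : towerHom p k a υ = 1)
    (n : ℕ) (x : cyclotomicLayer F₀ p n) : (υ : absoluteGaloisGroup ℚ) • (x : AlgebraicClosure ℚ) = x := by
  have h1 : Literature.NumberTheory.GaloisRepresentations.GaloisRep.cyclotomicCharacter ℚ p υ = 1 := by
    rw [← coe_towerHom_fst p k a υ, hυ]; rfl
  have h2 : ∀ y : AlgebraicClosure ℚ, y ^ k = (a : AlgebraicClosure ℚ) →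
      (υ : absoluteGaloisGroup ℚ) • y = y := fun y hy => by
    have := towerHom_snd_apply p k a υ ⟨y, hy⟩
    rw [hυ] at this
    exact this.symm
  -- the fixed field of `υ`
  let E : IntermediateField ℚ (AlgebraicClosure ℚ) :=
    IntermediateField.fixedField (Subgroup.zpowers (absoluteGaloisGroup.toAlgEquiv ℚ (υ : absoluteGaloisGroup ℚ)))
  have hE : ∀ y : AlgebraicClosure ℚ, y ∈ E ↔ (υ : absoluteGaloisGroup ℚ) • y = y := by
    intro y
    rw [IntermediateField.mem_fixedField_iff, absoluteGaloisGroup.smul_def]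
    constructor
    · intro h; exact h _ (Subgroup.mem_zpowers _)
    · intro h f hf
      exact MulAction.mem_stabilizer_iff.mp
        ((Subgroup.zpowers_le (H := MulAction.stabilizer _ y)).mpr (MulAction.mem_stabilizer_iff.mpr h) hf)
  have hF₀E : F₀ ≤ E := by
    rw [hF₀]
    exact IntermediateField.adjoin_le_iff.mpr fun y hy => (hE y).mpr (h2 y hy)
  have hroots : {x : AlgebraicClosure ℚ | x ^ p ^ (n + 1) = 1} ⊆ (E : Set (AlgebraicClosure ℚ)) := fun y hy => by
    show y ∈ E
    rw [hE]
    exact smul_eq_self_of_cyclotomicCharacter_eq_one p _ h1 hy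
  have hle : cyclotomicLayer F₀ p n ≤ E := by
    rw [cyclotomicLayer_def]
    exact sup_le hF₀E (IntermediateField.adjoin_le_iff.mpr hroots)
  exact (hE x).mp (hle x.2)

/-- The kernel of `towerHom` lies in the fixing subgroup of every layer. [cite: Tsuji1999, §3 (p. 6)] -/
theorem mem_fixingSubgroupQ_of_towerHom_eq_one
    (hF₀ : F₀ = IntermediateField.adjoin ℚ {x : AlgebraicClosure ℚ | x ^ k = (a : AlgebraicClosure ℚ)})
    (υ : torsionCyclotomicSubgroup p) (hυ : towerHom p k a υ = 1) (n : ℕ) :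
    (υ : absoluteGaloisGroup ℚ) ∈ fixingSubgroupQ (cyclotomicLayer F₀ p n) := by
  rw [mem_fixingSubgroupQ_iff]
  intro x hx
  exact smul_eq_self_of_towerHom_eq_one p F₀ k a hF₀ υ hυ n ⟨x, hx⟩

/-- **The quotient `Q = Υ ⧸ ker(towerHom)` is finite** (it embeds in `μ_t(ℤ_p) × Sym{x | x^k = a}`).
[cite: Tsuji1999, §3 (p. 6, «G = Gal(K/ℚ)» finite)] -/
theorem finite_towerQuot (hk : 0 < k) :
    Finite (torsionCyclotomicSubgroup p ⧸ (towerHom p k a).ker) := by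
  haveI : Finite (rootSubMulAction k a) := (finite_rootSubMulAction k a hk).to_subtype
  haveI : NeZero (torsionOrder p) := ⟨torsionOrder_ne_zero p⟩
  exact Finite.of_equiv _ (QuotientGroup.quotientKerEquivRange (towerHom p k a)).symm.toEquiv

/-- **`#Q` divides `#μ_t(ℤ_p) · (#{x | x^k = a})!`.** [cite: Tsuji1999, §3 (p. 6)] -/
theorem card_towerQuot_dvd (hk : 0 < k) :
    Nat.card (torsionCyclotomicSubgroup p ⧸ (towerHom p k a).ker) ∣
      Nat.card (rootsOfUnity (torsionOrder p) ℤ_[p]) * (Nat.card (rootSubMulAction k a)).factorial := by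
  classical
  haveI : Finite (rootSubMulAction k a) := (finite_rootSubMulAction k a hk).to_subtype
  haveI : NeZero (torsionOrder p) := ⟨torsionOrder_ne_zero p⟩
  haveI := Fintype.ofFinite (rootSubMulAction k a)
  rw [Nat.card_congr (QuotientGroup.quotientKerEquivRange (towerHom p k a)).toEquiv, ← Nat.card_perm,
    ← Nat.card_prod]
  exact Subgroup.card_subgroup_dvd_card _

/-- For odd `p`, `p ∤ #μ_{p−1}(ℤ_p)` (there are at most `p − 1 < p` such roots of unity, and at least one).
[cite: Serre1973, Ch. II §3.1 Prop. 7] -/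
theorem not_dvd_card_rootsOfUnity_torsionOrder (hp : p ≠ 2) :
    ¬ p ∣ Nat.card (rootsOfUnity (torsionOrder p) ℤ_[p]) := by
  intro h
  haveI : NeZero (torsionOrder p) := ⟨torsionOrder_ne_zero p⟩
  have hle : Nat.card (rootsOfUnity (torsionOrder p) ℤ_[p]) ≤ torsionOrder p := card_rootsOfUnity _ _
  have ht : torsionOrder p = p - 1 := by
    rw [torsionOrder, cyclotomicExponent, if_neg hp, pow_one, Nat.totient_prime (Fact.out : p.Prime)]
  have hpos : 0 < Nat.card (rootsOfUnity (torsionOrder p) ℤ_[p]) := Nat.card_pos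
  have := Nat.le_of_dvd hpos h
  have hp2 := (Fact.out : p.Prime).two_le
  omega

/-- **`p ∤ #Q`** when `p` is odd and `#{x | x^k = a} < p` (e.g. `k < p`): `#Q ∣ #μ_{p−1} · m!` with `m < p`.
[cite: Tsuji1999, §3 (p. 5–6, «p ∤ [K : ℚ]» in Remark 3)] -/
theorem not_dvd_card_towerQuot (hp : p ≠ 2) (hk : 0 < k) (hkp : k < p) :
    ¬ p ∣ Nat.card (torsionCyclotomicSubgroup p ⧸ (towerHom p k a).ker) := by
  intro h
  have hP : p.Prime := Fact.out
  have h' := Nat.dvd_trans h (card_towerQuot_dvd p k a hk)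
  rcases (Nat.Prime.dvd_mul hP).mp h' with h1 | h1
  · exact not_dvd_card_rootsOfUnity_torsionOrder p hp h1
  · rw [Nat.Prime.dvd_factorial hP] at h1
    have := card_rootSubMulAction_le k a hk
    omega

/-- Hence `#Q` is a unit of `ℤ_p`. [cite: Tsuji1999, §3 (p. 6, «e_χ = (1/#G)Σ…», #G invertible in ℤ_p)] -/
theorem isUnit_card_towerQuot (hp : p ≠ 2) (hk : 0 < k) (hkp : k < p) :
    IsUnit ((Nat.card (torsionCyclotomicSubgroup p ⧸ (towerHom p k a).ker) : ℤ_[p])) := by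
  rw [PadicInt.isUnit_iff]
  have h1 : ‖((Nat.card (torsionCyclotomicSubgroup p ⧸ (towerHom p k a).ker) : ℤ) : ℤ_[p])‖ ≤ 1 :=
    PadicInt.norm_le_one _
  have h : ¬ ‖((Nat.card (torsionCyclotomicSubgroup p ⧸ (towerHom p k a).ker) : ℤ) : ℤ_[p])‖ < 1 := by
    rw [PadicInt.norm_int_lt_one_iff_dvd, Int.natCast_dvd_natCast]
    exact not_dvd_card_towerQuot p k a hp hk hkp
  push_cast at h h1
  exact le_antisymm h1 (not_lt.mp h)

end TowerQuotient

end Summit.BirchSwinnertonDyer.Rank1Residual.Additive.GenusSeven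

end
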